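import Mathlib
import Literature.AlgebraicGeometry.Resolution.NormalCrossingsBlowupStepReduction
import Summits.ResolutionOfSingularities.ResolutionOfSingularities.Theorems.RadicialJungCleanModelsCleanProp44ChartRsop
import HarnessLib

/-!
# Route `RadicialJung`, crux `CleanModels` (stmt-ResolutionOfSingularities-15917), line `Sketch` rev 35, stub 6 `stub_cleanProp44` (X44c):
# THE σ-TOWER CHAINED (census (S1) + the residual of (S2)) — one storey of the ℕ-indexed tower in transportable form, and the induction along the tower

Seat decomp-res-hand-2 g23 (structural hand).  The g22 memo left, as the residual of the chart identification (S2) and the whole of (S1), the CHAINING of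
the storeys ✓ `exists_sigmaStep_of_isBlowup` along the ℕ-indexed σ-tower of memo 4e §2.5: blow up the point `c`, then the σ-curves `Z_0, Z_1, …`
(`Z_j = E_{Z_{j−1}} ∩ L̃`), following the points `z_1, z_2, …` of the strict transforms of the leaf `L = V(t)`; carry the invariant «`D_j = 𝒪_{X_j,z_j}/(t_j, v_j)`
is a localization of `K` at `M₀`» (for the point tower `K = κ(c)[u]`) and read, at every level, the exceptional divisor `𝒪_{X_j,z_j}/(v_j)` as a localization of
`K[T]`, `T ↦ t̄_j` — the input of ✓ `isLocalizationAtPrime_span_pair_of_mem` / ✓ `exists_prime_isLocalizationAtPrime_span`, hence of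
✓ `birth_descent_of_isLocalization` / ✓ `exists_successor_of_isLocalization`.

The tower is presented WITHOUT dependent-type glue: level `j` is a blowing up `τ_j : X_{j+1} → X_j` along `J_j` with a point `y_j ∈ X_{j+1}`, and the top
stalk of level `j` is identified with the bottom stalk of level `j+1` by a user-supplied ring isomorphism
`e_j : 𝒪_{X_{j+1}, y_j} ≅ 𝒪_{X_{j+1}, τ_{j+1}(y_{j+1})}` (in the application `τ_{j+1}(y_{j+1}) = y_j` and `e_j` is the canonical `stalkCongr`); all storey
outputs are ring-theoretic and are transported along `e_j`.  The user names the σ-curves by elements `t_j, v_j ∈ 𝒪_{X_j, τ_j y_j}` with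
`(t_j, v_j) = (J_j)_{τ_j y_j}` (the centre IS the σ-curve), `ψ_j v_j = v_{j+1}`, `ψ_j t_j = v_{j+1} t_{j+1}` (`ψ_j = e_j ∘ τ_j♯`), `t_{j+1} ∈ 𝔪` (the point
lies on the strict transform of the leaf) — exactly the relations `hv`, `ht` of ✓ `tower_face` — and composites `Ψ_j : 𝒪_0 → 𝒪_j` (`Ψ_0 = id`,
`Ψ_{j+1} = ψ_j ∘ Ψ_j`) through which the compatibility of `K`-structures is expressed («`algebraMap g = class of Ψ_j r₀` whenever `Λ₀ g = class of r₀`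
downstairs»).

* `sigmaTower_step` — ONE STOREY IN TRANSPORTABLE FORM: from `IsRsopPart ![t, v]`, `(t, v) = J_x`, the relations above and a compatible `K`-structure on
  `𝒪_x/(t, v)` which is a localization at `M₀`, to: `IsRsopPart ![t″, v″]` upstairs, `v″` a non-zero-divisor (`hvnzd` of ✓ `tower_face`), the quotients
  `𝒪″/(v″)`, `𝒪″/(t″, v″)` local, `𝒪_x/(t,v) → 𝒪″/(t″,v″)` bijective (stated representative-wise), EVERY compatible `K`-structure on `𝒪″/(t″, v″)` is a
  localization at `M₀` and one EXISTS, and every compatible `K[T]`-structure on `𝒪″/(v″)` with `T ↦ t″` is a localization of `K[T]`.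
* `sigmaTower_inv` — the induction: the invariant (`IsRsopPart ![t_j, v_j]` ∧ a compatible `K`-structure on `D_j`, localization at `M₀`) at every level `j ≤ d`.
* `sigmaTower` — **THE CHAINED TOWER**: for every `j < d`, all conclusions of `sigmaTower_step` at level `j + 1`, from the level-`0` data alone
  (`IsRsopPart ![t_0, v_0]` and a `K`-structure on `D_0` which is a localization at `M₀` — for the σ-tower over a closed point these come from
  ✓ `exists_pointStep_of_isBlowup` + ✓ `isRsopPart_pair_of_isBlowup` with `K = κ(c)[u]`).

Honest framing: OURS, bookkeeping only (the storeys are ✓ g22, the algebra is Mathlib's `Ideal.quotientEquiv` / `IsLocalization.isLocalization_of_algEquiv`);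
what remains of census (iii) after this file is (S3) [XS], (S4) [definitional], the comparison with the cocone on generators (✓ `isLocalization_of_agree_on_generators`),
(M) [M] and (R) [research]; nothing here proves X44c, any case of `CleanModels`, or resolution of singularities in characteristic `p`.
[cite: StacksProject, Tag 0804, Tag 0BIQ] [cite: Matsumura1987, Thm. 4.1–4.3, Thm. 14.2] [cite: CossartPiltant2008, Prop. 4.4 (proof, p. 11)]
[cite: CossartJannsenSaito2020, Lemma 7.5]
-/

noncomputable section

set_option linter.dupNamespace false -- mandated namespace of this single-conjunct summit

open IsLocalRing CategoryTheory AlgebraicGeometry Polynomial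
open Literature.AlgebraicGeometry.Resolution

namespace Summit.ResolutionOfSingularities.ResolutionOfSingularities.Theorems.RadicialJung.CleanModels

universe u

/-! ## §0 Transport helpers along a ring isomorphism -/

section Transport

variable {A B : Type u} [CommRing A] [CommRing B] (e : A ≃+* B)

/-- A ring isomorphism maps non-zero-divisors to non-zero-divisors. [folklore] -/
theorem mem_nonZeroDivisors_ringEquiv {a : A} (ha : a ∈ nonZeroDivisors A) : e a ∈ nonZeroDivisors B := by
  rw [← MulEquivClass.map_nonZeroDivisors e]
  exact Submonoid.mem_map_of_mem (f := (e : A →* B)) ha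

/-- The image of the ideal of a pair under a ring isomorphism, in the `![·, ·]` spelling of the storeys. [folklore] -/
theorem map_span_pair_eq_span_range (a b : A) (a' b' : B) (ha : e a = a') (hb : e b = b') :
    (Ideal.span {a, b}).map (e : A →+* B) = Ideal.span (Set.range ![b', a']) := by
  rw [Ideal.map_span, RingEquiv.coe_toRingHom, Set.image_pair, ha, hb, Matrix.range_cons_cons_empty, Set.pair_comm]

/-- The image of a principal ideal under a ring isomorphism. [folklore] -/
theorem map_span_singleton_eq (a : A) (a' : B) (ha : e a = a') :
    (Ideal.span {a}).map (e : A →+* B) = Ideal.span {a'} := by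
  rw [Ideal.map_span, RingEquiv.coe_toRingHom, Set.image_singleton, ha]

end Transport

/-! ## §1 One storey in transportable form -/

section Step

variable {X X' : Scheme.{u}} {τ : X' ⟶ X} {J : X.IdealSheafData}

set_option maxHeartbeats 800000 in
-- long statement and many transports; elaboration only
/-- **ONE STOREY OF THE σ-TOWER, TRANSPORTABLE FORM** (see the module docstring).  Data: a blowing up `τ` along `J` (`IsBlowup τ J`), a point `x′` over
`x = τ x′`, the σ-curve `(t, v) = J_x` with `(t, v)` part of a regular system of parameters of `𝒪_{X,x}`; a ring isomorphism `e : 𝒪_{X′,x′} ≅ A″` (the next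
level's bottom stalk), `ψ = e ∘ τ♯`, elements `t″, v″ ∈ A″` with `ψ v = v″`, `ψ t = v″ t″`, `t″ ∈ 𝔪_{A″}`; the base of the invariant: `Λ₀ : K → A₀/I₀`,
`Ψ : A₀ → 𝒪_{X,x}`, `Ψ″ = ψ ∘ Ψ`, and a `K`-structure on `𝒪_{X,x}/(t, v)` compatible with `Λ₀` through `Ψ` which is a localization at `M₀`.
[cite: StacksProject, Tag 0804, Tag 0BIQ] [cite: Matsumura1987, Thm. 4.1–4.3, Thm. 14.2] [cite: CossartPiltant2008, Prop. 4.4 (proof, p. 11)] -/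
theorem sigmaTower_step (hτ : IsBlowup τ J) (x' : X') (t v : X.presheaf.stalk (τ x')) (hrs : IsRsopPart ![t, v])
    (hcJ : Ideal.span (Set.range ![t, v]) = stalkIdeal J (τ x'))
    {A'' : Type u} [CommRing A''] [IsLocalRing A''] (e : X'.presheaf.stalk x' ≃+* A'')
    (ψ : X.presheaf.stalk (τ x') →+* A'') (hψ : ∀ r, ψ r = e ((τ.stalkMap x').hom r))
    (t'' v'' : A'') (hv : ψ v = v'') (ht : ψ t = v'' * t'') (ht𝔪 : t'' ∈ maximalIdeal A'')
    {K : Type u} [CommRing K] (M₀ : Submonoid K) {A₀ : Type u} [CommRing A₀] (I₀ : Ideal A₀) (Λ₀ : K →+* A₀ ⧸ I₀)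
    (Ψ : A₀ →+* X.presheaf.stalk (τ x')) (Ψ'' : A₀ →+* A'') (hΨ'' : ∀ r, Ψ'' r = ψ (Ψ r))
    (inst : Algebra K (X.presheaf.stalk (τ x') ⧸ Ideal.span (Set.range ![t, v])))
    (hcompat : ∀ (g : K) (r₀ : A₀), Λ₀ g = Ideal.Quotient.mk I₀ r₀ →
      @algebraMap K (X.presheaf.stalk (τ x') ⧸ Ideal.span (Set.range ![t, v])) _ _ inst g = Ideal.Quotient.mk _ (Ψ r₀))
    (hloc : @IsLocalization K _ M₀ (X.presheaf.stalk (τ x') ⧸ Ideal.span (Set.range ![t, v])) _ inst) :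
    IsRsopPart ![t'', v''] ∧ v'' ∈ nonZeroDivisors A'' ∧
      IsLocalRing (A'' ⧸ Ideal.span {v''}) ∧ IsLocalRing (A'' ⧸ Ideal.span (Set.range ![t'', v''])) ∧
      -- `𝒪_x/(t, v) → A″/(t″, v″)` is bijective (representative-wise)
      (∀ q : A'' ⧸ Ideal.span (Set.range ![t'', v'']), ∃ r, Ideal.Quotient.mk _ (ψ r) = q) ∧
      (∀ r, ψ r ∈ Ideal.span (Set.range ![t'', v'']) → r ∈ Ideal.span (Set.range ![t, v])) ∧
      -- every compatible `K`-structure upstairs is a localization at `M₀`, and one exists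
      (∀ inst'' : Algebra K (A'' ⧸ Ideal.span (Set.range ![t'', v''])),
        (∀ (g : K) (r₀ : A₀), Λ₀ g = Ideal.Quotient.mk I₀ r₀ →
          @algebraMap K (A'' ⧸ Ideal.span (Set.range ![t'', v''])) _ _ inst'' g = Ideal.Quotient.mk _ (Ψ'' r₀)) →
        @IsLocalization K _ M₀ (A'' ⧸ Ideal.span (Set.range ![t'', v''])) _ inst'') ∧
      (∃ inst'' : Algebra K (A'' ⧸ Ideal.span (Set.range ![t'', v''])),
        ∀ (g : K) (r₀ : A₀), Λ₀ g = Ideal.Quotient.mk I₀ r₀ →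
          @algebraMap K (A'' ⧸ Ideal.span (Set.range ![t'', v''])) _ _ inst'' g = Ideal.Quotient.mk _ (Ψ'' r₀)) ∧
      -- the exceptional divisor `A″/(v″)` is a localization of `K[T]`, `T ↦ t″`, for every compatible structure
      (∀ instE : Algebra K[X] (A'' ⧸ Ideal.span {v''}),
        (∀ (g : K) (r₀ : A₀), Λ₀ g = Ideal.Quotient.mk I₀ r₀ →
          @algebraMap K[X] (A'' ⧸ Ideal.span {v''}) _ _ instE (C g) = Ideal.Quotient.mk _ (Ψ'' r₀)) →
        @algebraMap K[X] (A'' ⧸ Ideal.span {v''}) _ _ instE Polynomial.X = Ideal.Quotient.mk _ t'' →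
        ∃ N : Submonoid K[X], @IsLocalization K[X] _ N (A'' ⧸ Ideal.span {v''}) _ instE) := by
  letI := inst
  haveI := hloc
  -- the regular system of parameters downstairs in the storeys' format
  obtain ⟨hR, l, w, hz, hdim⟩ := IsRsopPart.exists_append_eq_maximalIdeal hrs
  -- the fraction `t′ = e⁻¹ t″` and the relation `τ♯t = τ♯v · t′`
  set t' : X'.presheaf.stalk x' := e.symm t'' with ht'def
  have het' : e t' = t'' := by rw [ht'def, e.apply_symm_apply]
  have hev : e ((τ.stalkMap x').hom v) = v'' := by rw [← hψ, hv]
  have ht' : (τ.stalkMap x').hom (![t, v] 0) = (τ.stalkMap x').hom (![t, v] 1) * t' := by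
    apply e.injective
    change e ((τ.stalkMap x').hom t) = e ((τ.stalkMap x').hom v * t')
    rw [map_mul, het', hev, ← hψ, ht]
  have ht'𝔪 : t' ∈ maximalIdeal (X'.presheaf.stalk x') := by
    rw [← mem_maximalIdeal_ringEquiv_iff e, het']; exact ht𝔪
  -- `τ♯v` generates `J𝒪′` together with `τ♯t = τ♯v·t′`; it is a non-zero-divisor
  have hrel : ∀ k, (τ.stalkMap x').hom (![t, v] k) = (τ.stalkMap x').hom (![t, v] 1) * (![t', 1] : Fin 2 → X'.presheaf.stalk x') k := by
    intro k
    rcases Fin.exists_fin_two.mp ⟨k, rfl⟩ with h | h <;> rw [h]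
    · exact ht'
    · simp
  have hnzd1 := stalkMap_mem_nonZeroDivisors_of_isBlowup hτ x' ![t, v] hcJ 1 ![t', 1] hrel
  have hvJ : (τ.stalkMap x').hom v ∈ (stalkIdeal J (τ x')).map (τ.stalkMap x').hom := by
    rw [← hcJ]; exact Ideal.mem_map_of_mem _ (Ideal.subset_span ⟨1, rfl⟩)
  have hL : (τ.stalkMap x').hom (![t, v] 0) ∈ (stalkIdeal J (τ x')).map (τ.stalkMap x').hom * maximalIdeal (X'.presheaf.stalk x') := by
    rw [ht']; exact Ideal.mul_mem_mul hvJ ht'𝔪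
  have hJ0 : (stalkIdeal J (τ x')).map (τ.stalkMap x').hom ≠ ⊥ := by
    intro h0
    have : (τ.stalkMap x').hom v = 0 := by rw [h0, Ideal.mem_bot] at hvJ; exact hvJ
    exact nonZeroDivisors.ne_zero hnzd1 this
  -- THE STOREY for the prescribed `t′`
  obtain ⟨-, hnzd, hrs', hlocE, hlocZ, ⟨hsurj, hinj, hZ⟩, hE⟩ :=
    sigmaStep_of_isBlowup_of_eq hτ x' hR ![t, v] w hz hdim hcJ hL hJ0 t' ht'
  -- the two ideal transports along `e`
  have hIZ : Ideal.span (Set.range ![t'', v'']) =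
      (Ideal.span {(τ.stalkMap x').hom (![t, v] 1), t'}).map (e : X'.presheaf.stalk x' →+* A'') :=
    (map_span_pair_eq_span_range e _ _ v'' t'' hev het').symm
  have hIE : Ideal.span {v''} = (Ideal.span {(τ.stalkMap x').hom (![t, v] 1)}).map (e : X'.presheaf.stalk x' →+* A'') :=
    (map_span_singleton_eq e _ v'' hev).symm
  set eZ := Ideal.quotientEquiv _ _ e hIZ with heZ
  set eE := Ideal.quotientEquiv _ _ e hIE with heE
  have heZmk : ∀ r, eZ (Ideal.Quotient.mk _ r) = Ideal.Quotient.mk _ (e r) := fun r => Ideal.quotientEquiv_mk _ _ e hIZ r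
  have heZsymm : ∀ a, eZ.symm (Ideal.Quotient.mk _ a) = Ideal.Quotient.mk _ (e.symm a) := fun a => Ideal.quotientEquiv_symm_mk _ _ e hIZ a
  have heEmk : ∀ r, eE (Ideal.Quotient.mk _ r) = Ideal.Quotient.mk _ (e r) := fun r => Ideal.quotientEquiv_mk _ _ e hIE r
  have heEsymm : ∀ a, eE.symm (Ideal.Quotient.mk _ a) = Ideal.Quotient.mk _ (e.symm a) := fun a => Ideal.quotientEquiv_symm_mk _ _ e hIE a
  -- `τ♯` maps `(t, v)` into `(τ♯v, t′)` and into `(τ♯v)`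
  have hleZ : Ideal.span (Set.range ![t, v]) ≤ (Ideal.span {(τ.stalkMap x').hom (![t, v] 1), t'}).comap (τ.stalkMap x').hom := by
    rw [Ideal.span_le]
    rintro _ ⟨k, rfl⟩
    rw [SetLike.mem_coe, Ideal.mem_comap, hrel k]
    exact Ideal.mul_mem_right _ _ (Ideal.subset_span (by simp))
  have hleE : Ideal.span (Set.range ![t, v]) ≤ (Ideal.span {(τ.stalkMap x').hom (![t, v] 1)}).comap (τ.stalkMap x').hom := by
    rw [Ideal.span_le]
    rintro _ ⟨k, rfl⟩
    rw [SetLike.mem_coe, Ideal.mem_comap, hrel k]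
    exact Ideal.mul_mem_right _ _ (Ideal.mem_span_singleton_self _)
  -- for every `g : K` a representative downstairs
  have hrep : ∀ g : K, ∃ r₀ : A₀, Λ₀ g = Ideal.Quotient.mk I₀ r₀ := fun g => by
    obtain ⟨r₀, hr₀⟩ := Ideal.Quotient.mk_surjective (Λ₀ g); exact ⟨r₀, hr₀.symm⟩
  -- (1) IsRsopPart upstairs, transported
  have h1 : IsRsopPart ![t'', v''] := by
    have h := IsRsopPart.map_ringEquiv e hrs'
    have heq : (e : X'.presheaf.stalk x' → A'') ∘ ![t', (τ.stalkMap x').hom (![t, v] 1)] = ![t'', v''] := by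
      funext a
      fin_cases a
      · simp [het']
      · simpa using hev
    rwa [heq] at h
  -- (2) `v″` is a non-zero-divisor
  have h2 : v'' ∈ nonZeroDivisors A'' := by rw [← hev]; exact mem_nonZeroDivisors_ringEquiv e hnzd
  refine ⟨h1, h2, ?_, ?_, ?_, ?_, ?_, ?_, ?_⟩
  · -- (3) `A″/(v″)` local
    haveI := hlocE; exact eE.isLocalRing
  · -- (4) `A″/(t″, v″)` local
    haveI := hlocZ; exact eZ.isLocalRing
  · -- (5) surjectivity
    intro q
    obtain ⟨r, hr⟩ := hsurj (eZ.symm q)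
    refine ⟨r, ?_⟩
    rw [hψ, ← heZmk, hr, RingEquiv.apply_symm_apply]
  · -- (6) injectivity
    intro r hr
    apply hinj r
    rw [← Ideal.Quotient.eq_zero_iff_mem] at hr ⊢
    apply eZ.injective
    rw [heZmk, map_zero, ← hψ, hr]
  · -- (7) every compatible `K`-structure upstairs is a localization at `M₀`
    intro inst'' hcompat''
    letI instQ : Algebra K (X'.presheaf.stalk x' ⧸ Ideal.span {(τ.stalkMap x').hom (![t, v] 1), t'}) :=
      ((eZ.symm : _ →+* _).comp (@algebraMap K (A'' ⧸ Ideal.span (Set.range ![t'', v''])) _ _ inst'')).toAlgebra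
    have halgQ : ∀ g : K, algebraMap K (X'.presheaf.stalk x' ⧸ Ideal.span {(τ.stalkMap x').hom (![t, v] 1), t'}) g =
        eZ.symm (@algebraMap K (A'' ⧸ Ideal.span (Set.range ![t'', v''])) _ _ inst'' g) := fun g => rfl
    have hQ : IsLocalization M₀ (X'.presheaf.stalk x' ⧸ Ideal.span {(τ.stalkMap x').hom (![t, v] 1), t'}) := by
      refine hZ K M₀ instQ (fun g r hgr => ?_)
      obtain ⟨r₀, hr₀⟩ := hrep g
      have hcls : Ideal.Quotient.mk (Ideal.span (Set.range ![t, v])) r = Ideal.Quotient.mk _ (Ψ r₀) := by rw [hgr, hcompat g r₀ hr₀]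
      have hdiff : r - Ψ r₀ ∈ Ideal.span (Set.range ![t, v]) := by rw [← Ideal.Quotient.eq]; exact hcls
      have hdiff' : Ideal.Quotient.mk (Ideal.span {(τ.stalkMap x').hom (![t, v] 1), t'}) ((τ.stalkMap x').hom r) =
          Ideal.Quotient.mk _ ((τ.stalkMap x').hom (Ψ r₀)) := by
        rw [Ideal.Quotient.eq, ← map_sub]; exact hleZ hdiff
      rw [halgQ, hcompat'' g r₀ hr₀, hΨ'', hψ, heZsymm, e.symm_apply_apply, hdiff']
    -- transport along the algebra isomorphism `eZ`
    let eZa : (X'.presheaf.stalk x' ⧸ Ideal.span {(τ.stalkMap x').hom (![t, v] 1), t'}) ≃ₐ[K] (A'' ⧸ Ideal.span (Set.range ![t'', v''])) :=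
      { eZ with
        commutes' := fun g => by
          change eZ (algebraMap K _ g) = _
          rw [halgQ, RingEquiv.apply_symm_apply] }
    exact @IsLocalization.isLocalization_of_algEquiv K _ M₀ _ _ _ _ _ inst'' hQ eZa
  · -- (8) a compatible `K`-structure upstairs exists: `eZ ∘ (quotient map induced by τ♯) ∘ algebraMap`
    refine ⟨((eZ : _ →+* _).comp ((Ideal.quotientMap _ (τ.stalkMap x').hom hleZ).comp (algebraMap K _))).toAlgebra, fun g r₀ hr₀ => ?_⟩
    rw [RingHom.algebraMap_toAlgebra, RingHom.comp_apply, RingHom.comp_apply, hcompat g r₀ hr₀, Ideal.quotientMap_mk, RingEquiv.coe_toRingHom,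
      heZmk, ← hψ, hΨ'']
  · -- (9) the exceptional divisor is a localization of `K[T]`
    intro instE hcompatE hX
    letI instS : Algebra K[X] (X'.presheaf.stalk x' ⧸ Ideal.span {(τ.stalkMap x').hom (![t, v] 1)}) :=
      ((eE.symm : _ →+* _).comp (@algebraMap K[X] (A'' ⧸ Ideal.span {v''}) _ _ instE)).toAlgebra
    have halgS : ∀ q : K[X], algebraMap K[X] (X'.presheaf.stalk x' ⧸ Ideal.span {(τ.stalkMap x').hom (![t, v] 1)}) q =
        eE.symm (@algebraMap K[X] (A'' ⧸ Ideal.span {v''}) _ _ instE q) := fun q => rfl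
    obtain ⟨N, hN⟩ := hE K M₀ instS (fun g r hgr => by
        obtain ⟨r₀, hr₀⟩ := hrep g
        have hcls : Ideal.Quotient.mk (Ideal.span (Set.range ![t, v])) r = Ideal.Quotient.mk _ (Ψ r₀) := by rw [hgr, hcompat g r₀ hr₀]
        have hdiff : r - Ψ r₀ ∈ Ideal.span (Set.range ![t, v]) := by rw [← Ideal.Quotient.eq]; exact hcls
        have hdiff' : Ideal.Quotient.mk (Ideal.span {(τ.stalkMap x').hom (![t, v] 1)}) ((τ.stalkMap x').hom r) =
            Ideal.Quotient.mk _ ((τ.stalkMap x').hom (Ψ r₀)) := by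
          rw [Ideal.Quotient.eq, ← map_sub]; exact hleE hdiff
        rw [halgS, hcompatE g r₀ hr₀, hΨ'', hψ, heEsymm, e.symm_apply_apply, hdiff'])
      (by rw [halgS, hX, heEsymm])
    let eEa : (X'.presheaf.stalk x' ⧸ Ideal.span {(τ.stalkMap x').hom (![t, v] 1)}) ≃ₐ[K[X]] (A'' ⧸ Ideal.span {v''}) :=
      { eE with
        commutes' := fun q => by
          change eE (algebraMap K[X] _ q) = _
          rw [halgS, RingEquiv.apply_symm_apply] }
    exact ⟨N, @IsLocalization.isLocalization_of_algEquiv K[X] _ N _ _ _ _ _ instE hN eEa⟩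

end Step

/-! ## §2 The induction along the tower -/

section Tower

variable (d : ℕ) (Y : ℕ → Scheme.{u}) (τ : ∀ j, Y (j + 1) ⟶ Y j) (J : ∀ j, (Y j).IdealSheafData) (y : ∀ j, Y (j + 1))
  (e : ∀ j, (Y (j + 1)).presheaf.stalk (y j) ≃+* (Y (j + 1)).presheaf.stalk (τ (j + 1) (y (j + 1))))
  (ψ : ∀ j, (Y j).presheaf.stalk (τ j (y j)) →+* (Y (j + 1)).presheaf.stalk (τ (j + 1) (y (j + 1))))
  (t v : ∀ j, (Y j).presheaf.stalk (τ j (y j)))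
  {K : Type u} [CommRing K] (M₀ : Submonoid K)
  (Ψ : ∀ j, (Y 0).presheaf.stalk (τ 0 (y 0)) →+* (Y j).presheaf.stalk (τ j (y j)))
  (inst₀ : Algebra K ((Y 0).presheaf.stalk (τ 0 (y 0)) ⧸ Ideal.span (Set.range ![t 0, v 0])))

/-- **The invariant along the σ-tower** (induction on the level): for every `j ≤ d`, `(t_j, v_j)` is part of a regular system of parameters of
`𝒪_{Y_j, τ_j y_j}` and `D_j = 𝒪_{Y_j, τ_j y_j}/(t_j, v_j)` carries a `K`-structure compatible with the base one through `Ψ_j` which is a localization at `M₀`.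
Hypotheses: see the module docstring (`hτ` blowings up, `hψ` the glued stalk maps, `h0` the level-`0` r.s.p., `hcJ` the centres are the σ-curves, `hv`/`ht` the
relations of ✓ `tower_face`, `ht𝔪` the points follow the leaf, `hΨ0`/`hΨ` the composites, `hloc₀` the base localization). [cite: StacksProject, Tag 0804, Tag 0BIQ]
[cite: Matsumura1987, Thm. 4.1–4.3, Thm. 14.2] [cite: CossartPiltant2008, Prop. 4.4 (proof, p. 11)] -/
theorem sigmaTower_inv (hτ : ∀ j < d, IsBlowup (τ j) (J j)) (hψ : ∀ j < d, ∀ r, ψ j r = e j (((τ j).stalkMap (y j)).hom r))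
    (h0 : IsRsopPart ![t 0, v 0]) (hcJ : ∀ j < d, Ideal.span (Set.range ![t j, v j]) = stalkIdeal (J j) (τ j (y j)))
    (hv : ∀ j < d, ψ j (v j) = v (j + 1)) (ht : ∀ j < d, ψ j (t j) = v (j + 1) * t (j + 1))
    (ht𝔪 : ∀ j < d, t (j + 1) ∈ maximalIdeal ((Y (j + 1)).presheaf.stalk (τ (j + 1) (y (j + 1)))))
    (hΨ0 : ∀ r, Ψ 0 r = r) (hΨ : ∀ j < d, ∀ r, Ψ (j + 1) r = ψ j (Ψ j r))
    (hloc₀ : @IsLocalization K _ M₀ ((Y 0).presheaf.stalk (τ 0 (y 0)) ⧸ Ideal.span (Set.range ![t 0, v 0])) _ inst₀) :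
    ∀ j ≤ d, IsRsopPart ![t j, v j] ∧
      ∃ inst : Algebra K ((Y j).presheaf.stalk (τ j (y j)) ⧸ Ideal.span (Set.range ![t j, v j])),
        (∀ (g : K) (r₀ : (Y 0).presheaf.stalk (τ 0 (y 0))),
          @algebraMap K ((Y 0).presheaf.stalk (τ 0 (y 0)) ⧸ Ideal.span (Set.range ![t 0, v 0])) _ _ inst₀ g = Ideal.Quotient.mk _ r₀ →
          @algebraMap K ((Y j).presheaf.stalk (τ j (y j)) ⧸ Ideal.span (Set.range ![t j, v j])) _ _ inst g = Ideal.Quotient.mk _ (Ψ j r₀)) ∧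
        @IsLocalization K _ M₀ ((Y j).presheaf.stalk (τ j (y j)) ⧸ Ideal.span (Set.range ![t j, v j])) _ inst := by
  intro j
  induction j with
  | zero =>
    intro _
    exact ⟨h0, inst₀, fun g r₀ h => by rw [hΨ0]; exact h, hloc₀⟩
  | succ j ih =>
    intro hj
    have hj' : j < d := by omega
    obtain ⟨hrs, inst, hcompat, hloc⟩ := ih hj'.le
    obtain ⟨h1, -, -, -, -, -, hall, ⟨inst'', hc''⟩, -⟩ :=
      sigmaTower_step (hτ j hj') (y j) (t j) (v j) hrs (hcJ j hj') (e j) (ψ j) (hψ j hj') (t (j + 1)) (v (j + 1)) (hv j hj') (ht j hj')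
        (ht𝔪 j hj') M₀ (Ideal.span (Set.range ![t 0, v 0]))
        (@algebraMap K ((Y 0).presheaf.stalk (τ 0 (y 0)) ⧸ Ideal.span (Set.range ![t 0, v 0])) _ _ inst₀) (Ψ j) (Ψ (j + 1)) (hΨ j hj')
        inst hcompat hloc
    exact ⟨h1, inst'', hc'', hall inst'' hc''⟩

set_option maxHeartbeats 800000 in
-- long statement; elaboration only
/-- **THE σ-TOWER CHAINED** (census (S1) + the residual of (S2); see the module docstring for the data and hypotheses).  For every level `j < d`:
`(t_{j+1}, v_{j+1})` is part of a regular system of parameters; `v_{j+1}` is a non-zero-divisor (`hvnzd` of ✓ `tower_face`); `𝒪_{j+1}/(v_{j+1})` and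
`D_{j+1} = 𝒪_{j+1}/(t_{j+1}, v_{j+1})` are local; `D_j → D_{j+1}` (induced by `ψ_j`) is bijective; EVERY `K`-structure on `D_{j+1}` compatible with the base through
`Ψ_{j+1}` is a localization at `M₀`, and one exists; and EVERY `K[T]`-structure on the exceptional divisor `𝒪_{j+1}/(v_{j+1})` compatible with the base on
constants and with `T ↦ t̄_{j+1}` is a localization of `K[T]` at some submonoid — the input of ✓ `isLocalizationAtPrime_span_pair_of_mem` (births) /
✓ `exists_prime_isLocalizationAtPrime_span` (generic point of the near curve), hence of ✓ `birth_descent_of_isLocalization` / ✓ `exists_successor_of_isLocalization`.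
[cite: StacksProject, Tag 0804, Tag 0BIQ] [cite: Matsumura1987, Thm. 4.1–4.3, Thm. 14.2] [cite: CossartPiltant2008, Prop. 4.4 (proof, p. 11)]
[cite: CossartJannsenSaito2020, Lemma 7.5] -/
theorem sigmaTower (hτ : ∀ j < d, IsBlowup (τ j) (J j)) (hψ : ∀ j < d, ∀ r, ψ j r = e j (((τ j).stalkMap (y j)).hom r))
    (h0 : IsRsopPart ![t 0, v 0]) (hcJ : ∀ j < d, Ideal.span (Set.range ![t j, v j]) = stalkIdeal (J j) (τ j (y j)))
    (hv : ∀ j < d, ψ j (v j) = v (j + 1)) (ht : ∀ j < d, ψ j (t j) = v (j + 1) * t (j + 1))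
    (ht𝔪 : ∀ j < d, t (j + 1) ∈ maximalIdeal ((Y (j + 1)).presheaf.stalk (τ (j + 1) (y (j + 1)))))
    (hΨ0 : ∀ r, Ψ 0 r = r) (hΨ : ∀ j < d, ∀ r, Ψ (j + 1) r = ψ j (Ψ j r))
    (hloc₀ : @IsLocalization K _ M₀ ((Y 0).presheaf.stalk (τ 0 (y 0)) ⧸ Ideal.span (Set.range ![t 0, v 0])) _ inst₀) :
    ∀ j < d, IsRsopPart ![t (j + 1), v (j + 1)] ∧
      v (j + 1) ∈ nonZeroDivisors ((Y (j + 1)).presheaf.stalk (τ (j + 1) (y (j + 1)))) ∧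
      IsLocalRing ((Y (j + 1)).presheaf.stalk (τ (j + 1) (y (j + 1))) ⧸ Ideal.span {v (j + 1)}) ∧
      IsLocalRing ((Y (j + 1)).presheaf.stalk (τ (j + 1) (y (j + 1))) ⧸ Ideal.span (Set.range ![t (j + 1), v (j + 1)])) ∧
      (∀ q : (Y (j + 1)).presheaf.stalk (τ (j + 1) (y (j + 1))) ⧸ Ideal.span (Set.range ![t (j + 1), v (j + 1)]),
        ∃ r, Ideal.Quotient.mk _ (ψ j r) = q) ∧
      (∀ r, ψ j r ∈ Ideal.span (Set.range ![t (j + 1), v (j + 1)]) → r ∈ Ideal.span (Set.range ![t j, v j])) ∧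
      (∀ inst'' : Algebra K ((Y (j + 1)).presheaf.stalk (τ (j + 1) (y (j + 1))) ⧸ Ideal.span (Set.range ![t (j + 1), v (j + 1)])),
        (∀ (g : K) (r₀ : (Y 0).presheaf.stalk (τ 0 (y 0))),
          @algebraMap K ((Y 0).presheaf.stalk (τ 0 (y 0)) ⧸ Ideal.span (Set.range ![t 0, v 0])) _ _ inst₀ g = Ideal.Quotient.mk _ r₀ →
          @algebraMap K ((Y (j + 1)).presheaf.stalk (τ (j + 1) (y (j + 1))) ⧸ Ideal.span (Set.range ![t (j + 1), v (j + 1)])) _ _ inst'' g =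
            Ideal.Quotient.mk _ (Ψ (j + 1) r₀)) →
        @IsLocalization K _ M₀ ((Y (j + 1)).presheaf.stalk (τ (j + 1) (y (j + 1))) ⧸ Ideal.span (Set.range ![t (j + 1), v (j + 1)])) _ inst'') ∧
      (∃ inst'' : Algebra K ((Y (j + 1)).presheaf.stalk (τ (j + 1) (y (j + 1))) ⧸ Ideal.span (Set.range ![t (j + 1), v (j + 1)])),
        ∀ (g : K) (r₀ : (Y 0).presheaf.stalk (τ 0 (y 0))),
          @algebraMap K ((Y 0).presheaf.stalk (τ 0 (y 0)) ⧸ Ideal.span (Set.range ![t 0, v 0])) _ _ inst₀ g = Ideal.Quotient.mk _ r₀ →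
          @algebraMap K ((Y (j + 1)).presheaf.stalk (τ (j + 1) (y (j + 1))) ⧸ Ideal.span (Set.range ![t (j + 1), v (j + 1)])) _ _ inst'' g =
            Ideal.Quotient.mk _ (Ψ (j + 1) r₀)) ∧
      (∀ instE : Algebra K[X] ((Y (j + 1)).presheaf.stalk (τ (j + 1) (y (j + 1))) ⧸ Ideal.span {v (j + 1)}),
        (∀ (g : K) (r₀ : (Y 0).presheaf.stalk (τ 0 (y 0))),
          @algebraMap K ((Y 0).presheaf.stalk (τ 0 (y 0)) ⧸ Ideal.span (Set.range ![t 0, v 0])) _ _ inst₀ g = Ideal.Quotient.mk _ r₀ →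
          @algebraMap K[X] ((Y (j + 1)).presheaf.stalk (τ (j + 1) (y (j + 1))) ⧸ Ideal.span {v (j + 1)}) _ _ instE (C g) =
            Ideal.Quotient.mk _ (Ψ (j + 1) r₀)) →
        @algebraMap K[X] ((Y (j + 1)).presheaf.stalk (τ (j + 1) (y (j + 1))) ⧸ Ideal.span {v (j + 1)}) _ _ instE Polynomial.X =
          Ideal.Quotient.mk _ (t (j + 1)) →
        ∃ N : Submonoid K[X], @IsLocalization K[X] _ N ((Y (j + 1)).presheaf.stalk (τ (j + 1) (y (j + 1))) ⧸ Ideal.span {v (j + 1)}) _ instE) := by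
  intro j hj
  obtain ⟨hrs, inst, hcompat, hloc⟩ := sigmaTower_inv d Y τ J y e ψ t v M₀ Ψ inst₀ hτ hψ h0 hcJ hv ht ht𝔪 hΨ0 hΨ hloc₀ j hj.le
  exact sigmaTower_step (hτ j hj) (y j) (t j) (v j) hrs (hcJ j hj) (e j) (ψ j) (hψ j hj) (t (j + 1)) (v (j + 1)) (hv j hj) (ht j hj)
    (ht𝔪 j hj) M₀ (Ideal.span (Set.range ![t 0, v 0]))
    (@algebraMap K ((Y 0).presheaf.stalk (τ 0 (y 0)) ⧸ Ideal.span (Set.range ![t 0, v 0])) _ _ inst₀) (Ψ j) (Ψ (j + 1)) (hΨ j hj)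
    inst hcompat hloc

end Tower

end Summit.ResolutionOfSingularities.ResolutionOfSingularities.Theorems.RadicialJung.CleanModels

end
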